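import Summits.AtomisticToContinuum.Crystallization.Theorems.FreeSplittingCertificatesStrictSplittingRuleCoreDefsStar
import Summits.AtomisticToContinuum.Crystallization.Theorems.FreeSplittingCertificatesStrictSplittingRuleCoreFirstOrderDesignGeometry

/-!
# Summability of decaying covariant quadratic transfers over the hcp lattice

Helper of reshape r5 (lead c5) of crux `StrictSplittingRule` (stmt-AtomisticToContinuum-12560), line `registered`:
toward the glue `H2N ∧ H2F ⇒ CoreStarCoercive` (near-field LMI + far-field Korn export ⇒ H2⋆). Registered stub, landed
`--supports stmt-AtomisticToContinuum-12560`.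
-/

noncomputable section

namespace Summit.AtomisticToContinuum.Crystallization.Theorems.StrictSplittingRuleBirth

open scoped BigOperators Classical
open Literature.MathematicalPhysics.StatisticalMechanics
open Literature.Geometry.DiscreteGeometry
open Summit.AtomisticToContinuum.Crystallization.Theorems.PalmUnimodularRigidity.LayeredLawsSelectHcp
  (hcpSite ljSqDeriv)

/-- Euclidean `3`-space. -/
local notation "E3" => EuclideanSpace ℝ (Fin 3)

/-! ## Helpers -/

/-- The decay weight `q ↦ (1 + ‖y_q − y_p‖)⁻⁶` is summable over `ℤ³` for every base site `p` (covariance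
`h1_sub_eq` re-indexes it to `h1_summable_one_add_inv_pow`). [folklore] -/
theorem summableTransfer_summable_weight {a h : ℝ} (ha : 0 < a) (hh : 0 < h) (p : ℤ × ℤ × ℤ) :
    Summable fun q : ℤ × ℤ × ℤ => ((1 + ‖hcpSite a h q - hcpSite a h p‖)⁻¹) ^ 6 := by
  have hg := h1_summable_one_add_inv_pow ha hh (n := 6) (by norm_num)
  refine (Equiv.addLeft p).summable_iff.1 ?_
  by_cases hp : Even p.1
  · refine hg.congr fun d => ?_
    simp only [Function.comp_apply, Equiv.coe_addLeft, h1_sub_of_even a h hp d]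
  · refine ((Equiv.neg _).summable_iff.2 hg).congr fun d => ?_
    simp only [Function.comp_apply, Equiv.coe_addLeft, Equiv.neg_apply,
      h1_sub_of_odd a h (Int.not_even_iff_odd.1 hp) d, norm_neg]

/-- A real family dominated by `C (1 + ‖y_q − y_p‖)⁻⁶` is summable. [folklore] -/
theorem summableTransfer_summable_of_abs_le {a h C : ℝ} (ha : 0 < a) (hh : 0 < h) (p : ℤ × ℤ × ℤ)
    {F : ℤ × ℤ × ℤ → ℝ} (hF : ∀ q, |F q| ≤ C * ((1 + ‖hcpSite a h q - hcpSite a h p‖)⁻¹) ^ 6) :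
    Summable F :=
  Summable.of_norm_bounded ((summableTransfer_summable_weight ha hh p).mul_left C) fun q => by
    rw [Real.norm_eq_abs]; exact hF q

/-- A real family that vanishes wherever `u q = 0` and `u (q + s) = 0`, for a finitely supported field `u`, is
finitely supported, hence summable. [folklore] -/
theorem summableTransfer_summable_of_vanish {u : ℤ × ℤ × ℤ → E3} (hu : (Function.support u).Finite)
    (s : ℤ × ℤ × ℤ) {f : ℤ × ℤ × ℤ → ℝ} (hf : ∀ q, u q = 0 → u (q + s) = 0 → f q = 0) :
    Summable f := by
  refine summable_of_ne_finset_zero (s := hu.toFinset ∪ hu.toFinset.image fun x => x - s) fun q hq => ?_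
  rw [Finset.mem_union, not_or] at hq
  refine hf q ?_ ?_
  · by_contra hne
    exact hq.1 (hu.mem_toFinset.2 (Function.mem_support.2 hne))
  · by_contra hne
    exact hq.2 (Finset.mem_image.2 ⟨q + s, hu.mem_toFinset.2 (Function.mem_support.2 hne), by abel⟩)

/-- Guarding one value of a summable real family by `0` keeps it summable. [folklore] -/
theorem summableTransfer_guard (p : ℤ × ℤ × ℤ) {F : ℤ × ℤ × ℤ → ℝ} (hF : Summable F) :
    Summable fun q => if q = p then (0 : ℝ) else F q := by
  refine hF.summable_of_eq_zero_or_self fun q => ?_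
  split_ifs
  exacts [Or.inl rfl, Or.inr rfl]

/-! ## The stub -/

/-- **stub_summableTransfer** (r5 helper, glue): for `(1+r)⁻⁶`-decaying covariant transfer tables `M, N` over a
finite stencil `Y`, a finitely supported `u` and any site `p`, the family of antisymmetrised transfer terms (the second
series on the right of `CoreStarCoercive`) is summable over `ℤ³` (cofinitely only the `M(b p)(q−p)·e(p)e(p)` term survives,
and it is `O((1+‖y_q−y_p‖)⁻⁶)`; `h1_summable_one_add_inv_pow`). [folklore] -/
theorem stub_summableTransfer : ∀ a h C : ℝ, 0 < a → 0 < h → ∀ (Y : Finset (ℤ × ℤ × ℤ))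
    (M N : Bool → (ℤ × ℤ × ℤ) → (ℤ × ℤ × ℤ) → (ℤ × ℤ × ℤ) → ℝ),
    (∀ p q : ℤ × ℤ × ℤ, ∀ s s', |M (decide (Even p.1)) (q - p) s s'| ≤
        C * ((1 + ‖hcpSite a h q - hcpSite a h p‖)⁻¹) ^ 6 ∧
      |N (decide (Even p.1)) (q - p) s s'| ≤ C * ((1 + ‖hcpSite a h q - hcpSite a h p‖)⁻¹) ^ 6) →
    ∀ u : ℤ × ℤ × ℤ → E3, (Function.support u).Finite → ∀ p : ℤ × ℤ × ℤ,
      Summable fun q : ℤ × ℤ × ℤ => (if q = p then (0 : ℝ) else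
          ∑ s ∈ Y, ∑ s' ∈ Y,
            (M (decide (Even p.1)) (q - p) s s' *
                (inner ℝ (hcpSite a h (p + s) - hcpSite a h p) (u (p + s) - u p) *
                  inner ℝ (hcpSite a h (p + s') - hcpSite a h p) (u (p + s') - u p)) -
              M (decide (Even q.1)) (p - q) s s' *
                (inner ℝ (hcpSite a h (q + s) - hcpSite a h q) (u (q + s) - u q) *
                  inner ℝ (hcpSite a h (q + s') - hcpSite a h q) (u (q + s') - u q)) +
              (N (decide (Even p.1)) (q - p) s s' - N (decide (Even q.1)) (p - q) s' s) *
                (inner ℝ (hcpSite a h (p + s) - hcpSite a h p) (u (p + s) - u p) *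
                  inner ℝ (hcpSite a h (q + s') - hcpSite a h q) (u (q + s') - u q)))) := by
  intro a h C ha hh Y M N hMN u hu p
  refine summableTransfer_guard p (summable_sum fun s _ => summable_sum fun s' _ => ?_)
  refine (Summable.sub ?_ ?_).add ?_
  · exact (summableTransfer_summable_of_abs_le ha hh p fun q => (hMN p q s s').1).mul_right _
  · exact summableTransfer_summable_of_vanish hu s fun q h0 h1 => by simp [h0, h1]
  · exact summableTransfer_summable_of_vanish hu s' fun q h0 h1 => by simp [h0, h1]

end Summit.AtomisticToContinuum.Crystallization.Theorems.StrictSplittingRuleBirth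

end
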